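import Summits.QuantumFields.BalabanUV.Beta.SymCorrectorFaceDiv
import Summits.QuantumFields.BalabanUV.Beta.SymCorrectorSlot
import Summits.QuantumFields.BalabanUV.Beta.VertexReflectionContact
import Summits.QuantumFields.BalabanUV.Beta.AveragingWardRootedStencils

/-!
# `BalabanUV.Beta.SymCorrectorFaceGauge` — binder row D1, road «BF-x» junction (J1), brick TT10: **THE FACE FAMILY OF A STENCIL WITH A ROOTED SLOT
# WARD LETTER IS A DIAGONAL CONTACT, AND ITS CHAIN-RULE VERTEX IS THE CONTACT OF THE FACE GAUGE GENERATOR** — the fully dressed FACE vertex of the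
# road OWNER's `D1BFx/ChartDefectWords` (T3) is EXACTLY a pure-gauge vertex `G μ y = Λ μ y∘𝕄 − 𝕄∘Λ μ y` of `D1BFx/ColumnGaugeInvariance.hessKer_columnGauge_of_relInv`
# (OWNER N-g23-2 (β′) «book the sheet pieces as COMMUTATOR words through the face Ward identity»; an2 R-D1-g43-3 (2) «(J1) opened by the Ward program»)

THE MATHEMATICS.  leaf-03's slot adjunction (TT3b `SymCorrectorSlot.vertexOfK_conj_psiKS_eq_add`) writes the chain-rule vertex at the `Ψ̂_S`-transported kernel as
`vertexOfK (Ψ̂∘K∘Ψ̂ᵀ) n S μ y = vertexOfK K n S μ y + vertexOfK K n S^face μ y`, `S^face α x := faceWt r n α x • faceSum n S (blk n x)`, and TT7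
(`SymCorrectorFaceDiv.faceSum_eq_blockSum_divV`) says `faceSum n S Y = Σ_{u ∈ blockSitesF n Y} divV S u` — the face family is a BLOCK SUM OF PURE-GAUGE
first-order vertices (`Ψ̂_S − 1` is a pure gauge: `d` of a block-constant function).  Hence, for a stencil family obeying the POINTWISE rooted slot Ward
letter in the OWNER's shape `hS : ∀ u, divV S u = ξ • conjV 𝕄 (diagK (legInd ρ u))` (`D1BFx/ColumnGaugeGenerator.wsum_divV_eq_conjV_of_letters_smul`'s
hypothesis; an1's `AveragingWardRootedStencils.divV_vhSAt_eq_conjV` is the averaging table's, the OWNER's `divV_S0NAt_eq_smul_conjV` the native spine's at level 0):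
* §1 the BLOCK SUM of an1's leg indicators is the block-membership symbol: `Σ_{u ∈ blockSitesF n Y} legInd ρ u z b = [blk n (legSite ρ z b) = Y]`, and
  `Σ_{u ∈ blockSitesF n Y} ξ • conjV 𝕄 (diagK (legInd ρ u)) = conjV 𝕄 (diagK (z b ↦ ξ·[blk n (legSite ρ z b) = Y]))` (entrywise, `conjV_diagK_apply`); a letter with
  several sectors against a COMMON rooted generator (the comb literal's level-0 shape, OWNER F-g23-3) folds into the one-operator shape (`two_sector_fold`);
* §2 under `hS`: **`faceSum n S Y = conjV 𝕄 (diagK (z b ↦ ξ·[blk n (legSite ρ z b) = Y]))`**, the face family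
  **`S^face α x = conjV 𝕄 (diagK (z b ↦ [blk n (legSite ρ z b) = blk n x]·ξ·faceWt r n α x))`**, `slotPsiS r n S = S + (that)`;
* §3 LETTER-FREE, for ANY coefficients `c α x` and ANY `K`, `𝕄`: the chain-rule vertex of the block-contact family
  `α x ↦ conjV 𝕄 (diagK (z b ↦ [blk n (legSite ρ z b) = blk n x]·c α x))` is `conjV 𝕄 (diagK (z b ↦ Σ_α Σ_{x ∈ blockSitesF n (blk n (legSite ρ z b))} colH K n μ y α x·c α x))`
  (an3's `VertexReflectionContact.vertexOfK_conjV_diagK` on a finitely supported family — NO summability hypothesis);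
* §4 ⇒ **`vertexOfK (Ψ̂∘K∘Ψ̂ᵀ) n S μ y = vertexOfK K n S μ y + (comp (Λf μ y) 𝕄 − comp 𝕄 (Λf μ y))`** with THE FACE GAUGE GENERATOR
  **`Λf μ y := diagK (z b ↦ −Σ_α Σ_{x ∈ blockSitesF n (blk n (legSite ρ z b))} colH K n μ y α x·(ξ·faceWt r n α x))`** (a BLOCK-CONSTANT symbol in the leg's site) —
  the `G μ y` of `ColumnGaugeInvariance.hessKer_columnGauge_of_relInv` (v1.3 §3), sign included;
* §5 its sockets there: `|symbol z b| ≤ (d+1)·n^{d+1}·C·B·e^{δ(|ρ|₁ + (d+1)n)}·e^{−δ|z − n•y|₁}` from `Decays K C δ` and `|c| ≤ B`, hence `BiLoc (Λf μ y) (n•y) (n•y) _ (δ∕2)` and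
  `Loc (Λf μ y)`; `Λf μ y ∘ axEc = axEc ∘ Λf μ y` is an2's `comp_axEc_diagK_comm` (any diagonal kernel).

HONEST DEPENDENCY (cell records, verbatim): «continuum YM on T⁴ ⇐ BetaPertH ∧ nine spine estimates (0/9 proved); BetaPertH ⇐ (D1) ∧ (D4) ∧
CAP+tail; G-an2-4 gates asym, D1 and NE2/3/4.»  HONEST FRAMING (cell contract, verbatim): «discharging `BetaPertH` makes Bałaban's UV stability
UNCONDITIONAL — a real constructive-QFT result; it is NOT the continuum limit and NOT the Clay problem.»  THIS MODULE DISCHARGES NOTHING of (K), of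
(J1)'s row, of D1 or of the wall: [folklore] entrywise identities between OUR kernels BY NAME; the slot Ward letter `hS` is a HYPOTHESIS — which table obeys
it, with which `𝕄` and `ξ`, is the instance's located check (OWNER COLUMN-GAUGE-INSTANCE-SPEC-g23 (α)), NOT decided here; the LEG words `Ψ̂ᵀ∘X∘Ψ̂ − X` of (T3)
are untouched.  No definition, no `def … : Prop`, nothing cited, 0 sorry.  0∕4 row-D1 binders; (K) NOT closed; (J1) = ONE OPEN ROW; NOT D1, NEVER
«G-an2-4 closed», NOT `BetaPertH`, NOT continuum, NOT Clay.

ABSOLUTE RULE (cell charter, verbatim): «No internally-minted statement may enter as a cited fact. Every hypothesis is either kernel-proved in this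
package or a verbatim quotation of a PUBLISHED theorem with page reference. The manuscript(s) under audit are NOT citable for their own disputed
steps — they are the thing under adjudication; programme-internal (2001/route/tribunal) claims are never citable.»

D1 formalisation swarm LEAF 03 (`b2b-balaban-beta-d1-formalise-leaf-03`, gen 30), 2026-08-23; over TT3b∕TT7 (leaf-03), an3's `VertexReflectionContact`,
an2's `DiagonalContact`, an1's `AveragingWardRootedStencils` BY NAME; no existing file touched.
-/

open Finset
open scoped BigOperators
open Literature.MathematicalPhysics.QuantumFieldTheory
open Literature.MathematicalPhysics.QuantumFieldTheory.Balaban1983to89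
open Literature.MathematicalPhysics.QuantumFieldTheory.Balaban1983to89.Beta
open B12Sec2to5 (l1 l1_nonneg)
open ExpKernelCalculus (MKer Decays BiLoc comp l1_sub_triangle l1_sub_symm)
open OneStepResolventKernel (Fib wsum LocStencil)
open OneStepKernelFamily (colH vertexOfK abs_colH_le)
open KernelWard (divV)
open AffineAveraging (Site box toSite unitVec)
open AveragingContours (blk)
open Summit.QuantumFields.BalabanUV.Beta.TameKernelCalculus (Spr Loc trK)
open Summit.QuantumFields.BalabanUV.Beta.ChartConjugation (conjV)
open Summit.QuantumFields.BalabanUV.Beta.BorderedHessian (diagK diagK_apply conjV_diagK_apply comp_diagK_left comp_diagK_right comp_axEc_diagK_comm)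
open Summit.QuantumFields.BalabanUV.Beta.AxialDressingRooted (axEc)
open Summit.QuantumFields.BalabanUV.Beta.AveragingWardRootedStencils (legSite legInd legInd_apply)
open Summit.QuantumFields.BalabanUV.Beta.VertexReflectionContact (vertexOfK_conjV_diagK)
open Summit.QuantumFields.BalabanUV.Beta.CompositeCorrectorLocality (blockSitesF mem_blockSitesF_of_blk_eq)
open Summit.QuantumFields.BalabanUV.Beta.SymCorrectorKernel (psiKS)
open Summit.QuantumFields.BalabanUV.Beta.SymCorrectorFace (faceWt faceWtSum faceWtSum_nonneg abs_faceWt_le bondNbhd l1_le_of_mem_bondNbhd card_blockSitesF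
  faceSum slotPsiS)
open Summit.QuantumFields.BalabanUV.Beta.SymCorrectorSlot (vertexOfK_conj_psiKS vertexOfK_conj_psiKS_eq_add)
open Summit.QuantumFields.BalabanUV.Beta.SymCorrectorFaceDiv (mem_blockSitesF_iff blk_eq_of_mem_blockSitesF faceSum_eq_blockSum_divV)

namespace Summit.QuantumFields.BalabanUV.Beta.SymCorrectorFaceGauge

noncomputable section

variable {d : ℕ} {n : ℕ} (hn : 0 < n)
include hn

/-! ## §1 Block sums of leg indicators and of their diagonal contacts -/

/-- [folklore] **THE BLOCK SUM OF THE LEG INDICATORS IS THE BLOCK-MEMBERSHIP SYMBOL**: `Σ_{u ∈ blockSitesF n Y} legInd ρ u z b = [blk n (legSite ρ z b) = Y]`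
(exactly one varied site of the block carries the leg, iff the leg's site lies in the block). -/
theorem sum_blockSitesF_legInd (ρ : Site (d + 1)) (Y z : Site (d + 1)) (b : Fib d) :
    ∑ u ∈ blockSitesF n Y, legInd ρ u z b = if blk n (legSite ρ z b) = Y then 1 else 0 := by
  classical
  simp only [legInd_apply]
  rw [Finset.sum_ite_eq]
  by_cases h : blk n (legSite ρ z b) = Y
  · rw [if_pos ((mem_blockSitesF_iff hn).2 h), if_pos h]
  · rw [if_neg (fun hm => h ((mem_blockSitesF_iff hn).1 hm)), if_neg h]

/-- [folklore] A block sum of single-site indicators, scalar form: `Σ_{u ∈ blockSitesF n Y} [w = u] = [blk n w = Y]`. -/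
theorem sum_blockSitesF_ite_eq (Y w : Site (d + 1)) :
    ∑ u ∈ blockSitesF n Y, (if w = u then (1 : ℝ) else 0) = if blk n w = Y then 1 else 0 := by
  classical
  rw [Finset.sum_ite_eq]
  by_cases h : blk n w = Y
  · rw [if_pos ((mem_blockSitesF_iff hn).2 h), if_pos h]
  · rw [if_neg (fun hm => h ((mem_blockSitesF_iff hn).1 hm)), if_neg h]

/-- [folklore] **THE BLOCK SUM OF THE DIAGONAL SITE CONTACTS IS THE BLOCK CONTACT**: `Σ_{u ∈ blockSitesF n Y} ξ • conjV 𝕄 (diagK (legInd ρ u))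
= conjV 𝕄 (diagK (z b ↦ ξ·[blk n (legSite ρ z b) = Y]))` (entrywise: `conjV 𝕄 (diagK g) x z a b = 𝕄 x z a b·(g z b − g x a)`). -/
theorem sum_blockSitesF_smul_conjV_diagK_legInd (𝕄 : MKer (d + 1) (Fib d)) (ρ : Site (d + 1)) (ξ : ℝ) (Y : Site (d + 1)) :
    ∑ u ∈ blockSitesF n Y, ξ • conjV 𝕄 (diagK (legInd ρ u))
      = conjV 𝕄 (diagK fun z b => if blk n (legSite ρ z b) = Y then ξ else 0) := by
  classical
  funext p q a c
  rw [Finset.sum_apply, Finset.sum_apply, Finset.sum_apply, Finset.sum_apply]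
  simp only [Pi.smul_apply, smul_eq_mul, conjV_diagK_apply, legInd_apply]
  calc ∑ u ∈ blockSitesF n Y, ξ * (𝕄 p q a c * ((if legSite ρ q c = u then (1 : ℝ) else 0) - (if legSite ρ p a = u then (1 : ℝ) else 0)))
      = ξ * (𝕄 p q a c * (∑ u ∈ blockSitesF n Y, (if legSite ρ q c = u then (1 : ℝ) else 0)
          - ∑ u ∈ blockSitesF n Y, (if legSite ρ p a = u then (1 : ℝ) else 0))) := by
        rw [← Finset.sum_sub_distrib, Finset.mul_sum, Finset.mul_sum]
    _ = 𝕄 p q a c * ((if blk n (legSite ρ q c) = Y then ξ else 0) - (if blk n (legSite ρ p a) = Y then ξ else 0)) := by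
        rw [sum_blockSitesF_ite_eq hn, sum_blockSitesF_ite_eq hn]
        split_ifs <;> ring

omit hn in
/-- [folklore] A diagonal contact is ADDITIVE in the operator (entrywise) — so a slot letter with several sectors against a COMMON rooted generator,
`divV S u = Σᵢ ξᵢ • conjV 𝕄ᵢ (diagK (legInd ρ u))` (the comb literal's level-0 shape, OWNER F-g23-3 (1)∕(3)), folds into the one-operator shape `hS` below with
`𝕄 := Σᵢ ξᵢ • 𝕄ᵢ`, `ξ := 1`. -/
theorem conjV_add_left_diagK (A B : MKer (d + 1) (Fib d)) (g : Site (d + 1) → Fib d → ℝ) :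
    conjV (A + B) (diagK g) = conjV A (diagK g) + conjV B (diagK g) := by
  funext p q a c
  simp only [Pi.add_apply, conjV_diagK_apply]
  ring

omit hn in
/-- [folklore] A diagonal contact is HOMOGENEOUS in the operator (entrywise). -/
theorem conjV_smul_left_diagK (ξ : ℝ) (A : MKer (d + 1) (Fib d)) (g : Site (d + 1) → Fib d → ℝ) :
    conjV (ξ • A) (diagK g) = ξ • conjV A (diagK g) := by
  funext p q a c
  simp only [Pi.smul_apply, smul_eq_mul, conjV_diagK_apply]
  ring

omit hn in
/-- [folklore] **FOLDING A TWO-SECTOR LETTER**: `ξ₁ • conjV 𝕄₁ (diagK g) + ξ₂ • conjV 𝕄₂ (diagK g) = (1 : ℝ) • conjV (ξ₁ • 𝕄₁ + ξ₂ • 𝕄₂) (diagK g)`. -/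
theorem two_sector_fold (ξ₁ ξ₂ : ℝ) (𝕄₁ 𝕄₂ : MKer (d + 1) (Fib d)) (g : Site (d + 1) → Fib d → ℝ) :
    ξ₁ • conjV 𝕄₁ (diagK g) + ξ₂ • conjV 𝕄₂ (diagK g) = (1 : ℝ) • conjV (ξ₁ • 𝕄₁ + ξ₂ • 𝕄₂) (diagK g) := by
  rw [one_smul, conjV_add_left_diagK, conjV_smul_left_diagK, conjV_smul_left_diagK]

/-! ## §2 Under the pointwise rooted slot Ward letter: the face sum, the face family, the slot transport are diagonal contacts -/

section Letters

variable {S : Fin (d + 1) → Site (d + 1) → MKer (d + 1) (Fib d)} {𝕄 : MKer (d + 1) (Fib d)} {ρ : Site (d + 1)} {ξ : ℝ}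
  (hS : ∀ u, divV S u = ξ • conjV 𝕄 (diagK (legInd ρ u)))
include hS

/-- [folklore] **THE FACE SUM IS THE BLOCK CONTACT**: under `hS`, `faceSum n S Y = conjV 𝕄 (diagK (z b ↦ ξ·[blk n (legSite ρ z b) = Y]))`
(TT7 `faceSum_eq_blockSum_divV` + §1). -/
theorem faceSum_eq_conjV_of_letters (Y : Site (d + 1)) :
    faceSum n S Y = conjV 𝕄 (diagK fun z b => if blk n (legSite ρ z b) = Y then ξ else 0) := by
  rw [faceSum_eq_blockSum_divV hn S Y, Finset.sum_congr rfl fun u _ => hS u]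
  exact sum_blockSitesF_smul_conjV_diagK_legInd hn 𝕄 ρ ξ Y

/-- [folklore] **THE FACE FAMILY IS A DIAGONAL CONTACT**: under `hS`, the face family of `ChartDefectWords` (T3)
`S^face α x := faceWt r n α x • faceSum n S (blk n x) = conjV 𝕄 (diagK (z b ↦ [blk n (legSite ρ z b) = blk n x]·(ξ·faceWt r n α x)))`. -/
theorem faceFamily_eq_conjV_of_letters (r : Fin (d + 1) → ℕ) (α : Fin (d + 1)) (x : Site (d + 1)) :
    faceWt r n α x • faceSum n S (blk n x)
      = conjV 𝕄 (diagK fun z b => if blk n (legSite ρ z b) = blk n x then ξ * faceWt r n α x else 0) := by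
  rw [faceSum_eq_conjV_of_letters hn hS (blk n x)]
  funext p q a c
  simp only [Pi.smul_apply, smul_eq_mul, conjV_diagK_apply]
  split_ifs <;> ring

/-- [folklore] **THE SLOT TRANSPORT OF A FAMILY WITH THE LETTER**: `slotPsiS r n S α x = S α x + conjV 𝕄 (diagK (z b ↦ [blk n (legSite ρ z b) = blk n x]·(ξ·faceWt r n α x)))`. -/
theorem slotPsiS_eq_add_conjV_of_letters (r : Fin (d + 1) → ℕ) (α : Fin (d + 1)) (x : Site (d + 1)) :
    slotPsiS r n S α x = S α x + conjV 𝕄 (diagK fun z b => if blk n (legSite ρ z b) = blk n x then ξ * faceWt r n α x else 0) := by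
  rw [← faceFamily_eq_conjV_of_letters hn hS r α x]
  rfl

end Letters

/-! ## §3 Letter-free: the chain-rule vertex of a block-contact family is the contact of the dressed block symbol -/

omit hn in
/-- [folklore] Off the block of the leg's site the block-contact coefficient vanishes, so each weighted site series is finitely supported. -/
theorem blockContact_term_eq_zero_of_not_mem (hn : 0 < n) (K : MKer (d + 1) (Fib d)) (ρ : Site (d + 1)) (c : Fin (d + 1) → Site (d + 1) → ℝ)
    (μ : Fin (d + 1)) (y : Site (d + 1)) (α : Fin (d + 1)) (z : Site (d + 1)) (b : Fib d) :
    ∀ x ∉ blockSitesF n (blk n (legSite ρ z b)), colH K n μ y α x * (if blk n (legSite ρ z b) = blk n x then c α x else 0) = 0 := by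
  intro x hx
  rw [if_neg (fun h => hx (mem_blockSitesF_of_blk_eq hn h.symm)), mul_zero]

/-- [folklore] **THE CHAIN-RULE VERTEX OF A BLOCK-CONTACT FAMILY** (any `K`, `𝕄`, `ρ`, coefficients `c`; no letter, no summability hypothesis):
`vertexOfK K n (α x ↦ conjV 𝕄 (diagK (z b ↦ [blk n (legSite ρ z b) = blk n x]·c α x))) μ y
 = conjV 𝕄 (diagK (z b ↦ Σ_α Σ_{x ∈ blockSitesF n (blk n (legSite ρ z b))} colH K n μ y α x·c α x))` — an3's `vertexOfK_conjV_diagK`, the site series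
collapsing to the block of the leg's site. -/
theorem vertexOfK_blockContact_eq_conjV (K 𝕄 : MKer (d + 1) (Fib d)) (ρ : Site (d + 1)) (c : Fin (d + 1) → Site (d + 1) → ℝ)
    (μ : Fin (d + 1)) (y : Site (d + 1)) :
    vertexOfK K n (fun α x => conjV 𝕄 (diagK fun z b => if blk n (legSite ρ z b) = blk n x then c α x else 0)) μ y
      = conjV 𝕄 (diagK fun z b => ∑ α : Fin (d + 1), ∑ x ∈ blockSitesF n (blk n (legSite ρ z b)), colH K n μ y α x * c α x) := by
  have hsupp := blockContact_term_eq_zero_of_not_mem hn K ρ c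
  rw [vertexOfK_conjV_diagK K 𝕄 n (fun α x z b => if blk n (legSite ρ z b) = blk n x then c α x else 0)
    (fun μ' y' α z b => summable_of_ne_finset_zero (hsupp μ' y' α z b)) μ y]
  congr 2
  funext z b
  refine Finset.sum_congr rfl fun α _ => ?_
  rw [tsum_eq_sum (hsupp μ y α z b)]
  refine Finset.sum_congr rfl fun x hx => ?_
  rw [if_pos (blk_eq_of_mem_blockSitesF hn hx).symm]

omit hn in
/-- [folklore] The same contact written with the NEGATED symbol in the OWNER's orientation: `conjV 𝕄 (diagK g) = comp (diagK (−g)) 𝕄 − comp 𝕄 (diagK (−g))`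
(`ColumnGaugeInvariance`'s `G μ y := comp (Λ μ y) 𝕄 − comp 𝕄 (Λ μ y)`). -/
theorem conjV_diagK_eq_comm_neg (𝕄 : MKer (d + 1) (Fib d)) (g : Site (d + 1) → Fib d → ℝ) :
    conjV 𝕄 (diagK g) = comp (diagK fun z b => -g z b) 𝕄 - comp 𝕄 (diagK fun z b => -g z b) := by
  funext p q a c
  rw [conjV_diagK_apply, Pi.sub_apply, Pi.sub_apply, Pi.sub_apply, Pi.sub_apply, comp_diagK_left, comp_diagK_right]
  ring

/-! ## §4 The face vertex of the chart transport is the contact of THE FACE GAUGE GENERATOR -/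

section FaceVertex

variable {S : Fin (d + 1) → Site (d + 1) → MKer (d + 1) (Fib d)} {𝕄 : MKer (d + 1) (Fib d)} {ρ : Site (d + 1)} {ξ : ℝ}
  (hS : ∀ u, divV S u = ξ • conjV 𝕄 (diagK (legInd ρ u)))
include hS

/-- [folklore] **THE FACE VERTEX IS THE CONTACT OF THE DRESSED FACE SYMBOL**: under `hS`, for ANY `K` and root offset `r`,
`vertexOfK K n S^face μ y = conjV 𝕄 (diagK (z b ↦ Σ_α Σ_{x ∈ blockSitesF n (blk n (legSite ρ z b))} colH K n μ y α x·(ξ·faceWt r n α x)))`. -/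
theorem vertexOfK_faceFamily_eq_conjV_of_letters (K : MKer (d + 1) (Fib d)) (r : Fin (d + 1) → ℕ) (μ : Fin (d + 1)) (y : Site (d + 1)) :
    vertexOfK K n (fun α x => faceWt r n α x • faceSum n S (blk n x)) μ y
      = conjV 𝕄 (diagK fun z b => ∑ α : Fin (d + 1), ∑ x ∈ blockSitesF n (blk n (legSite ρ z b)), colH K n μ y α x * (ξ * faceWt r n α x)) := by
  have e : (fun α x => faceWt r n α x • faceSum n S (blk n x))
      = fun α x => conjV 𝕄 (diagK fun z b => if blk n (legSite ρ z b) = blk n x then ξ * faceWt r n α x else 0) :=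
    funext fun α => funext fun x => faceFamily_eq_conjV_of_letters hn hS r α x
  rw [e]
  exact vertexOfK_blockContact_eq_conjV hn K 𝕄 ρ (fun α x => ξ * faceWt r n α x) μ y

variable {r : Fin (d + 1) → ℕ} (hr : r ∈ box (d + 1) n) {K : MKer (d + 1) (Fib d)} (hK : Spr K) {Cs δs : ℝ} (hSl : LocStencil S Cs δs) (hδs : 0 < δs)
include hr hK hSl hδs

/-- [folklore] **THE SLOT-TRANSPORTED VERTEX = THE RAW VERTEX + THE FACE CONTACT**: under `hS`, for a spread `K` and a local stencil family,
`vertexOfK K n (slotPsiS r n S) μ y = vertexOfK K n S μ y + conjV 𝕄 (diagK (z b ↦ Σ_α Σ_{x ∈ blockSitesF n (blk n (legSite ρ z b))} colH K n μ y α x·(ξ·faceWt r n α x)))`. -/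
theorem vertexOfK_slotPsiS_eq_add_conjV_of_letters (μ : Fin (d + 1)) (y : Site (d + 1)) :
    vertexOfK K n (slotPsiS r n S) μ y
      = vertexOfK K n S μ y
        + conjV 𝕄 (diagK fun z b => ∑ α : Fin (d + 1), ∑ x ∈ blockSitesF n (blk n (legSite ρ z b)), colH K n μ y α x * (ξ * faceWt r n α x)) := by
  rw [← vertexOfK_conj_psiKS hn hr hK hSl hδs μ y, vertexOfK_conj_psiKS_eq_add hn hr hK hSl hδs μ y,
    vertexOfK_faceFamily_eq_conjV_of_letters hn hS K r μ y]

/-- [folklore] **THE CHART-TRANSPORTED VERTEX IS THE RAW VERTEX PLUS A PURE-GAUGE VERTEX OF THE OWNER's SHAPE**: under `hS`, for a spread `K`, a local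
stencil family and a root offset `r ∈ box (d+1) n`,
`vertexOfK (Ψ̂∘K∘Ψ̂ᵀ) n S μ y = vertexOfK K n S μ y + (comp (Λf μ y) 𝕄 − comp 𝕄 (Λf μ y))`, `Ψ̂ := psiKS r n`, with THE FACE GAUGE GENERATOR
`Λf μ y := diagK (z b ↦ −Σ_α Σ_{x ∈ blockSitesF n (blk n (legSite ρ z b))} colH K n μ y α x·(ξ·faceWt r n α x))` — the `G μ y := comp (Λ μ y) 𝕄 − comp 𝕄 (Λ μ y)` of
`D1BFx/ColumnGaugeInvariance.hessKer_columnGauge_of_relInv`, read at `Λ := Λf`. -/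
theorem vertexOfK_conj_psiKS_eq_add_faceGauge (μ : Fin (d + 1)) (y : Site (d + 1)) :
    vertexOfK (comp (comp (psiKS r n) K) (trK (psiKS r n))) n S μ y
      = vertexOfK K n S μ y
        + (comp (diagK fun z b => -(∑ α : Fin (d + 1), ∑ x ∈ blockSitesF n (blk n (legSite ρ z b)), colH K n μ y α x * (ξ * faceWt r n α x))) 𝕄
          - comp 𝕄 (diagK fun z b => -(∑ α : Fin (d + 1), ∑ x ∈ blockSitesF n (blk n (legSite ρ z b)), colH K n μ y α x * (ξ * faceWt r n α x)))) := by
  rw [vertexOfK_conj_psiKS_eq_add hn hr hK hSl hδs μ y, vertexOfK_faceFamily_eq_conjV_of_letters hn hS K r μ y,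
    conjV_diagK_eq_comm_neg]

end FaceVertex

/-! ## §5 Sockets of `hessKer_columnGauge_of_relInv` for the face gauge generator: size, bi-localisation, `Loc`, commutation with `axEc` -/

omit hn in
/-- [folklore] The leg's site is within `|ρ|₁` of the leg's index site. -/
theorem l1_sub_legSite_le (ρ z : Site (d + 1)) (b : Fib d) : l1 (z - legSite ρ z b) ≤ l1 ρ := by
  rcases b with α | m
  · simp only [AveragingWardRootedStencils.legSite_inl, sub_self]
    have : l1 (0 : Site (d + 1)) = 0 := by simp [B12Sec2to5.l1]
    rw [this]; exact l1_nonneg ρ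
  · simp only [AveragingWardRootedStencils.legSite_inr]
    rw [show z - (z + ρ) = -ρ from by abel]
    have : l1 (-ρ) = l1 ρ := by simp [B12Sec2to5.l1, abs_neg]
    rw [this]

/-- [folklore] A site of the block of `w` is within `ℓ¹`-distance `(d+1)·n` of `w` (TT3a `l1_le_of_mem_bondNbhd`, the block being part of every face neighbourhood). -/
theorem l1_sub_le_of_mem_blockSitesF {w x : Site (d + 1)} (hx : x ∈ blockSitesF n (blk n w)) : l1 (x - w) ≤ ((d + 1 : ℕ) : ℝ) * n := by
  have hx' : x ∈ bondNbhd n (blk n w) (0 : Fin (d + 1)) := by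
    rw [bondNbhd]; exact Finset.mem_union_left _ hx
  exact l1_le_of_mem_bondNbhd hn hx'

/-- [folklore] **THE SIZE OF THE DRESSED BLOCK SYMBOL**: for `Decays K C δ` (`δ ≥ 0`) and coefficients `|c α x| ≤ B` (`B ≥ 0`),
`|Σ_α Σ_{x ∈ blockSitesF n (blk n (legSite ρ z b))} colH K n μ y α x·c α x| ≤ ((d+1)·n^{d+1}·(C·B)·e^{δ(|ρ|₁ + (d+1)n)})·e^{−δ|z − n•y|₁}` — the column decays from the
coarse point, the block of the leg's site is within `|ρ|₁ + (d+1)n` of `z`. -/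
theorem abs_blockSymbol_le {K : MKer (d + 1) (Fib d)} {C δ : ℝ} (hK : Decays K C δ) (hδ : 0 ≤ δ) (ρ : Site (d + 1))
    {c : Fin (d + 1) → Site (d + 1) → ℝ} {B : ℝ} (hc : ∀ α x, |c α x| ≤ B) (hB : 0 ≤ B) (μ : Fin (d + 1)) (y z : Site (d + 1)) (b : Fib d) :
    |∑ α : Fin (d + 1), ∑ x ∈ blockSitesF n (blk n (legSite ρ z b)), colH K n μ y α x * c α x|
      ≤ (((d + 1 : ℕ) : ℝ) * (n : ℝ) ^ (d + 1) * (C * B) * Real.exp (δ * (l1 ρ + ((d + 1 : ℕ) : ℝ) * n)))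
        * Real.exp (-δ * l1 (z - (n : ℤ) • y)) := by
  have hC : 0 ≤ C := by
    have h := hK 0 0 (Sum.inl 0) (Sum.inl 0)
    rw [sub_self] at h
    have : l1 (0 : Site (d + 1)) = 0 := by simp [B12Sec2to5.l1]
    rw [this, mul_zero, Real.exp_zero, mul_one] at h
    exact (abs_nonneg _).trans h
  set w := legSite ρ z b with hw
  -- each term
  have hterm : ∀ α, ∀ x ∈ blockSitesF n (blk n w),
      |colH K n μ y α x * c α x| ≤ C * B * Real.exp (δ * (l1 ρ + ((d + 1 : ℕ) : ℝ) * n)) * Real.exp (-δ * l1 (z - (n : ℤ) • y)) := by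
    intro α x hx
    rw [abs_mul]
    have h1 := abs_colH_le (N := n) hK μ y α x
    have h2 := hc α x
    -- `|z − n•y| ≤ |z − w| + |w − x| + |x − n•y| ≤ |ρ|₁ + (d+1)n + |x − n•y|`
    have hzw : l1 (z - w) ≤ l1 ρ := l1_sub_legSite_le ρ z b
    have hwx : l1 (w - x) ≤ ((d + 1 : ℕ) : ℝ) * n := by rw [l1_sub_symm]; exact l1_sub_le_of_mem_blockSitesF hn hx
    have htri : l1 (z - (n : ℤ) • y) ≤ l1 ρ + ((d + 1 : ℕ) : ℝ) * n + l1 (x - (n : ℤ) • y) :=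
      calc l1 (z - (n : ℤ) • y) ≤ l1 (z - x) + l1 (x - (n : ℤ) • y) := l1_sub_triangle _ _ _
        _ ≤ (l1 (z - w) + l1 (w - x)) + l1 (x - (n : ℤ) • y) := by
            have := l1_sub_triangle z w x; linarith
        _ ≤ _ := by linarith
    have hexp : Real.exp (-δ * l1 (x - (n : ℤ) • y))
        ≤ Real.exp (δ * (l1 ρ + ((d + 1 : ℕ) : ℝ) * n)) * Real.exp (-δ * l1 (z - (n : ℤ) • y)) := by
      rw [← Real.exp_add]
      exact Real.exp_le_exp.2 (by nlinarith)
    calc |colH K n μ y α x| * |c α x| ≤ (C * Real.exp (-δ * l1 (x - (n : ℤ) • y))) * B :=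
          mul_le_mul h1 h2 (abs_nonneg _) (by positivity)
      _ = C * B * Real.exp (-δ * l1 (x - (n : ℤ) • y)) := by ring
      _ ≤ C * B * (Real.exp (δ * (l1 ρ + ((d + 1 : ℕ) : ℝ) * n)) * Real.exp (-δ * l1 (z - (n : ℤ) • y))) :=
          mul_le_mul_of_nonneg_left hexp (by positivity)
      _ = _ := by ring
  calc |∑ α : Fin (d + 1), ∑ x ∈ blockSitesF n (blk n w), colH K n μ y α x * c α x|
      ≤ ∑ α : Fin (d + 1), |∑ x ∈ blockSitesF n (blk n w), colH K n μ y α x * c α x| := Finset.abs_sum_le_sum_abs _ _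
    _ ≤ ∑ α : Fin (d + 1), ∑ x ∈ blockSitesF n (blk n w), |colH K n μ y α x * c α x| :=
        Finset.sum_le_sum fun α _ => Finset.abs_sum_le_sum_abs _ _
    _ ≤ ∑ α : Fin (d + 1), ∑ x ∈ blockSitesF n (blk n w),
          C * B * Real.exp (δ * (l1 ρ + ((d + 1 : ℕ) : ℝ) * n)) * Real.exp (-δ * l1 (z - (n : ℤ) • y)) :=
        Finset.sum_le_sum fun α _ => Finset.sum_le_sum fun x hx => hterm α x hx
    _ = _ := by
        rw [Finset.sum_const, Finset.sum_const, card_blockSitesF, Finset.card_univ, Fintype.card_fin, nsmul_eq_mul, nsmul_eq_mul]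
        push_cast
        ring

omit hn in
/-- [folklore] **A DIAGONAL KERNEL WITH A DECAYING SYMBOL IS BI-LOCALISED**: `|g z b| ≤ A·e^{−δ|z − p|₁}` ⟹ `BiLoc (diagK g) p p A (δ∕2)`. -/
theorem biLoc_diagK_of_abs_le {g : Site (d + 1) → Fib d → ℝ} {p : Site (d + 1)} {A δ : ℝ}
    (hg : ∀ z b, |g z b| ≤ A * Real.exp (-δ * l1 (z - p))) : BiLoc (diagK g) p p A (δ / 2) := by
  classical
  have hA : 0 ≤ A := by
    have h := hg p (Sum.inl 0)
    rw [sub_self] at h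
    have : l1 (0 : Site (d + 1)) = 0 := by simp [B12Sec2to5.l1]
    rw [this, mul_zero, Real.exp_zero, mul_one] at h
    exact (abs_nonneg _).trans h
  intro x z a b
  rw [diagK_apply]
  split_ifs with h
  · obtain ⟨rfl, rfl⟩ := h
    refine (hg x a).trans (le_of_eq ?_)
    congr 1
    congr 1
    ring
  · rw [abs_zero]
    positivity

/-- [folklore] **THE FACE GAUGE GENERATOR IS BI-LOCALISED AT THE COARSE POINT**: for `Decays K C δ` (`δ ≥ 0`), in-block or not, any root offset `r`, any `ξ`,
`BiLoc (Λf μ y) (n•y) (n•y) ((d+1)·n^{d+1}·(C·(|ξ|·faceWtSum r n))·e^{δ(|ρ|₁ + (d+1)n)}) (δ∕2)`. -/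
theorem biLoc_faceGauge {K : MKer (d + 1) (Fib d)} {C δ : ℝ} (hK : Decays K C δ) (hδ : 0 ≤ δ) (ρ : Site (d + 1)) (r : Fin (d + 1) → ℕ) (ξ : ℝ)
    (μ : Fin (d + 1)) (y : Site (d + 1)) :
    BiLoc (diagK fun z b => -(∑ α : Fin (d + 1), ∑ x ∈ blockSitesF n (blk n (legSite ρ z b)), colH K n μ y α x * (ξ * faceWt r n α x)))
      ((n : ℤ) • y) ((n : ℤ) • y)
      (((d + 1 : ℕ) : ℝ) * (n : ℝ) ^ (d + 1) * (C * (|ξ| * faceWtSum r n)) * Real.exp (δ * (l1 ρ + ((d + 1 : ℕ) : ℝ) * n))) (δ / 2) := by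
  refine biLoc_diagK_of_abs_le fun z b => ?_
  rw [abs_neg]
  have hc : ∀ α x, |ξ * faceWt r n α x| ≤ |ξ| * faceWtSum r n := fun α x => by
    rw [abs_mul]; exact mul_le_mul_of_nonneg_left (abs_faceWt_le hn r α x) (abs_nonneg ξ)
  exact abs_blockSymbol_le hn hK hδ ρ hc (mul_nonneg (abs_nonneg ξ) (faceWtSum_nonneg r n)) μ y z b

/-- [folklore] **… HENCE LOCALISED** (`Loc`, the socket `hΛ` of `hessKer_columnGauge_of_relInv`), for a kernel decaying at a positive rate. -/
theorem loc_faceGauge {K : MKer (d + 1) (Fib d)} {C δ : ℝ} (hK : Decays K C δ) (hδ : 0 < δ) (ρ : Site (d + 1)) (r : Fin (d + 1) → ℕ) (ξ : ℝ)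
    (μ : Fin (d + 1)) (y : Site (d + 1)) :
    Loc (diagK fun z b => -(∑ α : Fin (d + 1), ∑ x ∈ blockSitesF n (blk n (legSite ρ z b)), colH K n μ y α x * (ξ * faceWt r n α x))) :=
  ⟨(n : ℤ) • y, (n : ℤ) • y, _, δ / 2, half_pos hδ, biLoc_faceGauge hn hK hδ.le ρ r ξ μ y⟩

omit hn in
/-- [folklore] **THE FACE GAUGE GENERATOR COMMUTES WITH THE AXIAL COORDINATE PROJECTOR** (socket `hΛE` of `hessKer_columnGauge_of_relInv` at `E := axEc ρ′ N`;
an2's `comp_axEc_diagK_comm`, any diagonal kernel). -/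
theorem comp_faceGauge_axEc_comm (g : Site (d + 1) → Fib d → ℝ) (ρ' : Site (d + 1)) (N : ℕ) :
    comp (diagK g) (axEc ρ' N) = comp (axEc ρ' N) (diagK g) :=
  (comp_axEc_diagK_comm g ρ' N).symm

end

end Summit.QuantumFields.BalabanUV.Beta.SymCorrectorFaceGauge
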